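import Summits.QuantumFields.BalabanUV.T4Continuum.Support.NE7MinActHessianLagrangian
import Summits.QuantumFields.BalabanUV.T4Continuum.Support.NE7MinActC2Lift
import Summits.QuantumFields.BalabanUV.T4Continuum.Support.NE7StabiliserLiftingUniform
import HarnessLib

/-!
# NE7MinActC2AllDataUniform — ✓ `NE7MinActHessianLagrangianAllData` AND ✓ `NE7MinActC2AllData` (road t4-ne7-p1 gen 115, ROAD-G115 §6 G3c ∕ G2) RE-ASSEMBLED WITH THE
# LEVEL-UNIFORM STABILISER LIFTING ✓ `NE7StabiliserLiftingUniform.stabiliser_lifting_uniform` (row NE7b gen 159): `∃ δ_V ∀ j` FOR THE MULTIPLIER, THE BORDERED HESSIAN AND `C²`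

Cell `pub-balaban`, rung (B)+1 sub-cell t4, lineage `b2b-balaban-t4-ne7b-p1` (row NE7b OWNER + CRUX PROVER; junction service for row NE7, ruling R-OWNER-149-1 (2)), generation 159 —
filed ON BEHALF OF the road t4-ne7-p1 (the same ten-line re-assembly as ✓ `NE7MinimiserC1AllDataUniform`; the road may cite or supersede this leaf).  Index `t4/b2b-balaban-t4-ne7b-p1/g159/INDEX.md`.
THE RE-ASSEMBLY.  In the road's proofs the radii from ✓ `NE7MinimalOrbitDatumContinuity.thresholds`, ✓ `NE7MinActMultiplier.multiplier_eq_fderiv_minAct_of_lift`,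
✓ `NE7MinActHessianLagrangian.minAct_hessian_lagrangian_of_lift`, ✓ `NE7MinActC2Lift.minAct_contDiffAt_two_of_lift` are ALREADY uniform in the level; only the lifting radius of
✓ p824904 `NE7StabiliserLifting.stabiliser_lifting` (`∀ k ∃ δ_V`) was level-dependent; ✓ p830442 `stabiliser_lifting_uniform` (`∃ δ_V ∀ k`) moves `∃ δ_V` in front of `∀ j` — verbatim otherwise.
WHAT ([folklore]; 0 def, 0 sorry; `d = 4`, every `U(n)`, `L ≥ 2`).  **`multiplier_eq_fderiv_minAct_allData_uniform`**, **`minAct_hessian_lagrangian_allData_uniform`**,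
**`minAct_contDiffAt_two_allData_uniform`**: the statements of ✓ `NE7MinActHessianLagrangianAllData.multiplier_eq_fderiv_minAct_allData` ∕ `minAct_hessian_lagrangian_allData` and
✓ `NE7MinActC2AllData.minAct_contDiffAt_two_allData` with `∀ j ∃ δ_V` replaced by `∃ δ_V ∀ j`.
HONEST FRAMING (page 1): composition of landed kernel theorems; radii∕constants existential (depend on `ε`, `n`, `N`, `L` — NOT on the level `j`, NOT on `V₀`); statements CENTRED at
`V₀` (germs at each small datum in the exponential chart), not global sections; `C²`, NOT the analyticity [B11] p. 279 asserts; OUR minimisers (B11 (8) with `sfClass`), OUR route, NOT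
Bałaban's method; nothing of Bałaban's asserted; NOT NE7 as a spine node, NOT NE3; row NE7b NOT PRINTED ∕ NOT PROVED; spine 0∕9; finite T⁴ rung (B)+1 — NOT infinite volume, NOT mass
gap, NOT BetaPertH, NOT Clay (continuum YM on T⁴ ⇐ BetaPertH ∧ nine spine estimates).
-/

set_option autoImplicit false

open scoped BigOperators Matrix Matrix.Norms.L2Operator Topology
open NormedSpace Finset Set Filter Metric

namespace Summit.QuantumFields.BalabanUV.T4Continuum.NE7MinActC2AllDataUniform

open Literature.MathematicalPhysics.QuantumFieldTheory.Balaban1983to89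
open B7Prop1Explicit B7Prop2Explicit
open T4AveragingDeficitWall (IsUnitaryCfg SmallField fineAction)
open T4AveragingDeficitWallBoundary (IsPeriodicCfg)
open AveragingDeficitTorusChart (TDir chart)
open AveragingDeficitTwoLevelPrep (skewSub)
open AveragingDeficitMultiLevelPrep (tower levelQ levelQ')
open MinimalActionLevels (perWin stepWt)
open MinimalActionSandwich (IsMinimiser minAct)
open MinimalActionRate (sfClass)
open NE3EnergyShapes (IsUnitarySite IsPeriodicSite)
open NE7MinimalOrbitDatumContinuity (thresholds)
open NE7MinActMultiplier (multiplier_eq_fderiv_minAct_of_lift)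
open NE7MinActHessianLagrangian (minAct_hessian_lagrangian_of_lift)
open NE7MinActC2Lift (minAct_contDiffAt_two_of_lift)
open NE7StabiliserLiftingUniform (stabiliser_lifting_uniform)

noncomputable section

variable {n : Type} [Fintype n] [DecidableEq n]

/-- **THE MULTIPLIER IDENTITY AT EVERY SMALL DATUM, ONE DATUM RADIUS FOR ALL LEVELS** — ✓ `NE7MinActHessianLagrangianAllData.multiplier_eq_fderiv_minAct_allData` with `∃ δ_V ∀ j`. [folklore] -/
theorem multiplier_eq_fderiv_minAct_allData_uniform [Nonempty n] {L : ℕ} [NeZero L] (hL : 2 ≤ L) :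
    ∃ ε₀ : ℝ, 0 < ε₀ ∧ ∀ ε : ℝ, 0 < ε → ε ≤ ε₀ → ∀ (N : ℕ) [NeZero N], 1 ≤ N → ∃ δV : ℝ, 0 < δV ∧ ∀ j : ℕ,
        ∀ V₀ ∈ {V : Site 4 → Fin 4 → (Matrix n n ℂ)ˣ | IsUnitaryCfg V ∧ IsPeriodicCfg V (N : ℤ) ∧ SmallField V δV},
        ∀ Us : Site 4 → Fin 4 → (Matrix n n ℂ)ˣ, IsMinimiser 4 (sfClass 4 L N ε) L N (j + 1) V₀ Us →
        (∀ Z : ↥(skewSub 4 n (L * tower L N j)), levelQ' L N j Us (Z : TDir 4 n (L * tower L N j)) = 0 → fderiv ℝ (fun Φ : ↥(skewSub 4 n (L * tower L N j)) => fineAction (chart (ContinuousLinearMap.id ℝ (Matrix n n ℂ)) (L * tower L N j) Us (Φ : TDir 4 n (L * tower L N j))) (perWin 4 (N * L ^ (j + 1)))) 0 Z = 0) ∧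
        ∀ Z : ↥(skewSub 4 n (L * tower L N j)),
          ((stepWt 4 L)⁻¹) ^ (j + 1) * fderiv ℝ (fun Φ : ↥(skewSub 4 n (L * tower L N j)) => fineAction (chart (ContinuousLinearMap.id ℝ (Matrix n n ℂ)) (L * tower L N j) Us (Φ : TDir 4 n (L * tower L N j))) (perWin 4 (N * L ^ (j + 1)))) 0 Z = fderiv ℝ (fun y : ↥(skewSub 4 n N) => minAct 4 (sfClass 4 L N ε) L N (j + 1) (chart (ContinuousLinearMap.id ℝ (Matrix n n ℂ)) N V₀ (y : TDir 4 n N))) 0 (levelQ' L N j Us (Z : TDir 4 n (L * tower L N j))) := by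
  obtain ⟨ε₂, hε₂, H2⟩ := multiplier_eq_fderiv_minAct_of_lift (n := n) hL
  obtain ⟨ε₃, hε₃, H3⟩ := stabiliser_lifting_uniform (n := n) hL
  refine ⟨min ε₂ ε₃, lt_min hε₂ hε₃, fun ε hε hεle N _ hN => ?_⟩
  obtain ⟨δ₂, hδ₂, hM⟩ := H2 ε hε (hεle.trans (min_le_left _ _)) N hN
  obtain ⟨δ₃, hδ₃, hlift⟩ := H3 ε hε (hεle.trans (min_le_right _ _)) N hN
  refine ⟨min δ₂ δ₃, lt_min hδ₂ hδ₃, fun j V₀ hV₀ Us hUs => ?_⟩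
  obtain ⟨hV₀u, hV₀P, hV₀δ⟩ := hV₀
  exact hM V₀ ⟨hV₀u, hV₀P, MinimalActionRate.SmallField.mono hV₀δ (min_le_left _ _)⟩ j Us hUs
    fun s hsu hsP hsfix => hlift (j + 1) V₀ ⟨hV₀u, hV₀P, MinimalActionRate.SmallField.mono hV₀δ (min_le_right _ _)⟩ Us hUs s hsu hsP hsfix

/-- **THE BORDERED HESSIAN AT EVERY SMALL DATUM, ONE DATUM RADIUS FOR ALL LEVELS** — ✓ `NE7MinActHessianLagrangianAllData.minAct_hessian_lagrangian_allData` with `∃ δ_V ∀ j`. [folklore] -/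
theorem minAct_hessian_lagrangian_allData_uniform [Nonempty n] {L : ℕ} [NeZero L] (hL : 2 ≤ L) :
    ∃ ε₀ : ℝ, 0 < ε₀ ∧ ∀ ε : ℝ, 0 < ε → ε ≤ ε₀ → ∀ (N : ℕ) [NeZero N], 1 ≤ N → ∃ δV : ℝ, 0 < δV ∧ ∀ j : ℕ,
        ∀ V₀ ∈ {V : Site 4 → Fin 4 → (Matrix n n ℂ)ˣ | IsUnitaryCfg V ∧ IsPeriodicCfg V (N : ℤ) ∧ SmallField V δV},
        (∃ Us : Site 4 → Fin 4 → (Matrix n n ℂ)ˣ, IsMinimiser 4 (sfClass 4 L N ε) L N (j + 1) V₀ Us) ∧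
        ∀ Us : Site 4 → Fin 4 → (Matrix n n ℂ)ˣ, IsMinimiser 4 (sfClass 4 L N ε) L N (j + 1) V₀ Us →
        ContDiffAt ℝ 2 (fun y : ↥(skewSub 4 n N) => minAct 4 (sfClass 4 L N ε) L N (j + 1) (chart (ContinuousLinearMap.id ℝ (Matrix n n ℂ)) N V₀ (y : TDir 4 n N))) 0 ∧
        ∀ v : ↥(skewSub 4 n N),
          IsLeast {q : ℝ | ∃ X : ↥(skewSub 4 n (L * tower L N j)), levelQ' L N j Us (X : TDir 4 n (L * tower L N j)) = v ∧
              q = ((stepWt 4 L)⁻¹) ^ (j + 1) * fderiv ℝ (fderiv ℝ (fun Φ : ↥(skewSub 4 n (L * tower L N j)) => fineAction (chart (ContinuousLinearMap.id ℝ (Matrix n n ℂ)) (L * tower L N j) Us (Φ : TDir 4 n (L * tower L N j))) (perWin 4 (N * L ^ (j + 1))))) 0 X X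
                  - fderiv ℝ (fun y : ↥(skewSub 4 n N) => minAct 4 (sfClass 4 L N ε) L N (j + 1) (chart (ContinuousLinearMap.id ℝ (Matrix n n ℂ)) N V₀ (y : TDir 4 n N))) 0 (fderiv ℝ (fderiv ℝ (fun Φ : ↥(skewSub 4 n (L * tower L N j)) => levelQ L N j Us (chart (ContinuousLinearMap.id ℝ (Matrix n n ℂ)) (L * tower L N j) Us (Φ : TDir 4 n (L * tower L N j))))) 0 X X)}
            (fderiv ℝ (fderiv ℝ (fun y : ↥(skewSub 4 n N) => minAct 4 (sfClass 4 L N ε) L N (j + 1) (chart (ContinuousLinearMap.id ℝ (Matrix n n ℂ)) N V₀ (y : TDir 4 n N)))) 0 v v) := by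
  obtain ⟨ε₁, hε₁, H⟩ := thresholds (n := n) hL
  obtain ⟨ε₂, hε₂, H2⟩ := minAct_hessian_lagrangian_of_lift (n := n) hL
  obtain ⟨ε₃, hε₃, H3⟩ := stabiliser_lifting_uniform (n := n) hL
  refine ⟨min ε₁ (min ε₂ ε₃), lt_min hε₁ (lt_min hε₂ hε₃), fun ε hε hεle N _ hN => ?_⟩
  obtain ⟨-, -, -, H1⟩ := H ε hε (hεle.trans (min_le_left _ _))
  obtain ⟨δ₁, hδ₁, hint₁⟩ := H1 N hN
  obtain ⟨δ₂, hδ₂, hB⟩ := H2 ε hε (hεle.trans ((min_le_right _ _).trans (min_le_left _ _))) N hN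
  obtain ⟨δ₃, hδ₃, hlift⟩ := H3 ε hε (hεle.trans ((min_le_right _ _).trans (min_le_right _ _))) N hN
  refine ⟨min δ₁ (min δ₂ δ₃), lt_min hδ₁ (lt_min hδ₂ hδ₃), fun j V₀ hV₀ => ?_⟩
  obtain ⟨hV₀u, hV₀P, hV₀δ⟩ := hV₀
  have hV₀1 : V₀ ∈ {V : Site 4 → Fin 4 → (Matrix n n ℂ)ˣ | IsUnitaryCfg V ∧ IsPeriodicCfg V (N : ℤ) ∧ SmallField V δ₁} :=
    ⟨hV₀u, hV₀P, MinimalActionRate.SmallField.mono hV₀δ (min_le_left _ _)⟩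
  have hV₀2 : V₀ ∈ {V : Site 4 → Fin 4 → (Matrix n n ℂ)ˣ | IsUnitaryCfg V ∧ IsPeriodicCfg V (N : ℤ) ∧ SmallField V δ₂} :=
    ⟨hV₀u, hV₀P, MinimalActionRate.SmallField.mono hV₀δ ((min_le_right _ _).trans (min_le_left _ _))⟩
  have hV₀3 : V₀ ∈ {V : Site 4 → Fin 4 → (Matrix n n ℂ)ˣ | IsUnitaryCfg V ∧ IsPeriodicCfg V (N : ℤ) ∧ SmallField V δ₃} :=
    ⟨hV₀u, hV₀P, MinimalActionRate.SmallField.mono hV₀δ ((min_le_right _ _).trans (min_le_right _ _))⟩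
  refine ⟨?_, fun Us hUs => ?_⟩
  · obtain ⟨U₀, hU₀, -⟩ := hint₁ V₀ hV₀1 (j + 1)
    exact ⟨U₀, hU₀⟩
  · exact hB V₀ hV₀2 j Us hUs fun s hsu hsP hsfix => hlift (j + 1) V₀ hV₀3 Us hUs s hsu hsP hsfix

/-- **THE CONSTRAINED MINIMAL ACTION IS `C²` IN THE DATUM AT EVERY SMALL DATUM, ONE DATUM RADIUS FOR ALL LEVELS** — ✓ `NE7MinActC2AllData.minAct_contDiffAt_two_allData` with
`∃ δ_V ∀ j`. [folklore] -/
theorem minAct_contDiffAt_two_allData_uniform [Nonempty n] {L : ℕ} [NeZero L] (hL : 2 ≤ L) :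
    ∃ ε₀ : ℝ, 0 < ε₀ ∧ ∀ ε : ℝ, 0 < ε → ε ≤ ε₀ → ∀ (N : ℕ) [NeZero N], 1 ≤ N → ∃ δV : ℝ, 0 < δV ∧ ∀ j : ℕ,
        ∀ V₀ ∈ {V : Site 4 → Fin 4 → (Matrix n n ℂ)ˣ | IsUnitaryCfg V ∧ IsPeriodicCfg V (N : ℤ) ∧ SmallField V δV},
          ContDiffAt ℝ 2 (fun y : ↥(skewSub 4 n N) => minAct 4 (sfClass 4 L N ε) L N (j + 1) (chart (ContinuousLinearMap.id ℝ (Matrix n n ℂ)) N V₀ (y : TDir 4 n N))) 0 := by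
  obtain ⟨ε₁, hε₁, H⟩ := thresholds (n := n) hL
  obtain ⟨ε₂, hε₂, H2⟩ := minAct_contDiffAt_two_of_lift (n := n) hL
  obtain ⟨ε₃, hε₃, H3⟩ := stabiliser_lifting_uniform (n := n) hL
  refine ⟨min ε₁ (min ε₂ ε₃), lt_min hε₁ (lt_min hε₂ hε₃), fun ε hε hεle N _ hN => ?_⟩
  obtain ⟨-, -, -, H1⟩ := H ε hε (hεle.trans (min_le_left _ _))
  obtain ⟨δ₁, hδ₁, hint₁⟩ := H1 N hN
  obtain ⟨δ₂, hδ₂, hC2⟩ := H2 ε hε (hεle.trans ((min_le_right _ _).trans (min_le_left _ _))) N hN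
  obtain ⟨δ₃, hδ₃, hlift⟩ := H3 ε hε (hεle.trans ((min_le_right _ _).trans (min_le_right _ _))) N hN
  refine ⟨min δ₁ (min δ₂ δ₃), lt_min hδ₁ (lt_min hδ₂ hδ₃), fun j V₀ hV₀ => ?_⟩
  obtain ⟨hV₀u, hV₀P, hV₀δ⟩ := hV₀
  have hV₀1 : V₀ ∈ {V : Site 4 → Fin 4 → (Matrix n n ℂ)ˣ | IsUnitaryCfg V ∧ IsPeriodicCfg V (N : ℤ) ∧ SmallField V δ₁} :=
    ⟨hV₀u, hV₀P, MinimalActionRate.SmallField.mono hV₀δ (min_le_left _ _)⟩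
  have hV₀2 : V₀ ∈ {V : Site 4 → Fin 4 → (Matrix n n ℂ)ˣ | IsUnitaryCfg V ∧ IsPeriodicCfg V (N : ℤ) ∧ SmallField V δ₂} :=
    ⟨hV₀u, hV₀P, MinimalActionRate.SmallField.mono hV₀δ ((min_le_right _ _).trans (min_le_left _ _))⟩
  have hV₀3 : V₀ ∈ {V : Site 4 → Fin 4 → (Matrix n n ℂ)ˣ | IsUnitaryCfg V ∧ IsPeriodicCfg V (N : ℤ) ∧ SmallField V δ₃} :=
    ⟨hV₀u, hV₀P, MinimalActionRate.SmallField.mono hV₀δ ((min_le_right _ _).trans (min_le_right _ _))⟩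
  obtain ⟨Us, hUs, -⟩ := hint₁ V₀ hV₀1 (j + 1)
  obtain ⟨Sl, θS, KT, iK, zs, -, -, -, -, -, -, -, -, -, -, hC2', -⟩ :=
    hC2 V₀ hV₀2 j Us hUs fun s hsu hsP hsfix => hlift (j + 1) V₀ hV₀3 Us hUs s hsu hsP hsfix
  exact hC2'

end

end Summit.QuantumFields.BalabanUV.T4Continuum.NE7MinActC2AllDataUniform
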